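import Summits.CriticalPhenomena.CardyFormulaZ2.Theorems.CardySelfDualSegmentUniformMarginalityStubFixedDomainContinuityOne
import Summits.CriticalPhenomena.CardyFormulaZ2.Theorems.CardySelfDualSegmentUniformMarginalityWildFromRectilinear

/-!
# `UniformMarginality` from the three split children (glue for the strategist's certified split)

Crux `UniformMarginality` (stmt-CriticalPhenomena-5472, route `CardySelfDualSegment`), line `Sketch`, lead
prover-line-stmt-CriticalPhenomena-5472-c4-0.  The crux-strategist `cstrat-stmt-CriticalPhenomena-5472-s1` prepared a
typed 3-way split of the crux (`Cruxes/UniformMarginality/StrategistSplit.md`, `STRATEGY-CENSUS.md` §Decomposition):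

* `UniformMarginalityRect` (crux, XL) — the crux with the rectilinearity hypothesis on `R` (= stub (B₁)
  `stub_integratedBoundRectilinear` of the line, by `uniformMarginalityRect_iff_integratedBoundRectilinear`);
* `FixedDomainContinuityInterior` (crux, L) — single-model a-priori domain continuity of the crude `M_{t₀}`-crossing
  probability at a wild centre `R` against `ε₀`-close rectilinear test domains, `0 < t₀ < 1` (= the v6 kernel (B₂a″) on
  the open interval);
* `FixedDomainContinuityOne` (support) — the same at `t₀ = 1`; PROVED here (`fixedDomainContinuityOne_holds`) from the
  landed `fixedDomainContinuity_one` (p140668).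

Planners cannot write `Theorems/`, so the glue theorem the `--glue-by` variant of the split needs is landed here, with
the three children as hypotheses VERBATIM in the route file's `let`-style (no definitions are introduced; the children
are spelled out in the binders): `Split.UniformMarginality_of_subs : «UniformMarginalityRect» →
«FixedDomainContinuityInterior» → «FixedDomainContinuityOne» → CardySelfDualSegment.UniformMarginality`.
Proof = the landed v6/v10 chain: case glue `fixedDomainContinuity_of_cases` with the landed base-point kernel
`fixedDomainContinuity_zero` (p116559), then `stub_uniformSandwichOfFixedDomainContinuity` (p116281) →
`stub_transportOfUniformSandwich` (p111792) → `uniformMarginality_of_integratedBound` (p96304).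
`Split.UniformMarginality_of_two_subs` is the glue with child 3 already discharged (children 1 + 2 ⟹ crux).
-/

noncomputable section

namespace Summit.CriticalPhenomena.CardyFormulaZ2.Cruxes.UniformMarginality.HeatFlow.Split

open Set Metric MeasureTheory
open Literature.Probability.Percolation Literature.Probability.LatticeModels
  Literature.Probability.RandomPlanarGeometry

/-- **Child 2 ⟹ the open-interval kernel (B₂a″)** in the shape consumed by `fixedDomainContinuity_of_cases`
(child 2 = `FixedDomainContinuityInterior`, verbatim in the binder). -/
theorem fixedDomainContinuity_interior_of_sub
    (h₂ : let prm : unitInterval → Literature.Probability.LatticeModels.Site 2 × Fin 2 → unitInterval := fun t i => if i.2 = 0 then Literature.Probability.Percolation.half else Literature.Probability.Percolation.half * t; let cfg : Set (Literature.Probability.LatticeModels.Site 2 × Fin 2) → Literature.Probability.Percolation.BondConfig (Literature.Probability.LatticeModels.Site 2) := fun S => {e | ∃ v : Literature.Probability.LatticeModels.Site 2, (e = s(v, v + ![1, 0]) ∧ (v, (0 : Fin 2)) ∈ S) ∨ (e = s(v, v + ![0, 1]) ∧ ((v, (0 : Fin 2)) ∈ S ↔ (v, (1 : Fin 2)) ∉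 S))}; let P : unitInterval → Literature.Probability.RandomPlanarGeometry.ConformalRectangle → ℝ → ℝ := fun t R δ => (Literature.Probability.LatticeModels.prodBernoulli (prm t)).real {S | cfg S ∈ Literature.Probability.Percolation.embDomainCrossing Literature.Probability.LatticeModels.squareLatticeEmbedding.z R.carrier δ (R.arc 0) (R.arc 2)}; (∀ (R : Literature.Probability.RandomPlanarGeometry.ConformalRectangle) (t₀ : unitInterval), 0 < (t₀ : ℝ) → (t₀ : ℝ) < 1 → ∀ (ε : ℝ), 0 < ε → ∃ ε₀ > 0, ∀ Q : Literature.Probability.RandomPlanarGeometry.ConformalRectangle, (∃ S : Finset (ℂ × ℂ), (∀ p ∈ S, p.1.re = p.2.re ∨ p.1.im = p.2.im) ∧ frontier Q.carrier ⊆ ⋃ p ∈ S, segment ℝ p.1 p.2) → (∀ u : ℝ, dist (Q.boundary u) (R.boundary u) ≤ ε₀) → (∀ i : Fin 4, |Q.mark i - R.mark i| ≤ ε₀) → ∃ δ₀ > 0, ∀ δ : ℝ, 0 < δ → δ < δ₀ → |P t₀ Q δ - P t₀ R δ| ≤ ε)) :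
    ∀ (R : ConformalRectangle) (t₀ : ℝ), t₀ ∈ Set.Ioo (0 : ℝ) 1 → ∀ ε : ℝ, 0 < ε →
      ∃ ε₀ > 0, ∀ Q : ConformalRectangle,
        (∃ S : Finset (ℂ × ℂ), (∀ p ∈ S, p.1.re = p.2.re ∨ p.1.im = p.2.im) ∧
          frontier Q.carrier ⊆ ⋃ p ∈ S, segment ℝ p.1 p.2) →
        (∀ u : ℝ, dist (Q.boundary u) (R.boundary u) ≤ ε₀) → (∀ i : Fin 4, |Q.mark i - R.mark i| ≤ ε₀) →
        ∃ δ₀ > 0, ∀ δ : ℝ, 0 < δ → δ < δ₀ → |Pext Q δ t₀ - Pext R δ t₀| ≤ ε := by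
  intro R t₀ ht₀ ε hε
  obtain ⟨ε₀, hε₀, hmain⟩ := h₂ R ⟨t₀, ⟨ht₀.1.le, ht₀.2.le⟩⟩ ht₀.1 ht₀.2 ε hε
  refine ⟨ε₀, hε₀, fun Q hQ hb hm => ?_⟩
  obtain ⟨δ₀, hδ₀, h⟩ := hmain Q hQ hb hm
  refine ⟨δ₀, hδ₀, fun δ hδ hδlt => ?_⟩
  have e1 : Pext Q δ t₀ = cornerCrossingProb ⟨t₀, ⟨ht₀.1.le, ht₀.2.le⟩⟩ Q δ :=
    Pext_coe Q δ ⟨t₀, ⟨ht₀.1.le, ht₀.2.le⟩⟩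
  have e2 : Pext R δ t₀ = cornerCrossingProb ⟨t₀, ⟨ht₀.1.le, ht₀.2.le⟩⟩ R δ :=
    Pext_coe R δ ⟨t₀, ⟨ht₀.1.le, ht₀.2.le⟩⟩
  rw [e1, e2]
  exact h δ hδ hδlt

/-- **Child 3 ⟹ the endpoint kernel at `t₀ = 1`** in the shape consumed by `fixedDomainContinuity_of_cases`
(child 3 = `FixedDomainContinuityOne`, verbatim in the binder). -/
theorem fixedDomainContinuity_one_of_sub
    (h₃ : let prm : unitInterval → Literature.Probability.LatticeModels.Site 2 × Fin 2 → unitInterval := fun t i => if i.2 = 0 then Literature.Probability.Percolation.half else Literature.Probability.Percolation.half * t; let cfg : Set (Literature.Probability.LatticeModels.Site 2 × Fin 2) → Literature.Probability.Percolation.BondConfig (Literature.Probability.LatticeModels.Site 2) := fun S => {e | ∃ v : Literature.Probability.LatticeModels.Site 2, (e = s(v, v + ![1, 0]) ∧ (v, (0 : Fin 2)) ∈ S) ∨ (e = s(v, v + ![0, 1]) ∧ ((v, (0 : Fin 2)) ∈ S ↔ (v, (1 : Fin 2)) ∉ S))}; let P : unitInterval → Literature.Probability.RandomPlanarGeometry.ConformalRectangle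 → ℝ → ℝ := fun t R δ => (Literature.Probability.LatticeModels.prodBernoulli (prm t)).real {S | cfg S ∈ Literature.Probability.Percolation.embDomainCrossing Literature.Probability.LatticeModels.squareLatticeEmbedding.z R.carrier δ (R.arc 0) (R.arc 2)}; (∀ (R : Literature.Probability.RandomPlanarGeometry.ConformalRectangle) (ε : ℝ), 0 < ε → ∃ ε₀ > 0, ∀ Q : Literature.Probability.RandomPlanarGeometry.ConformalRectangle, (∃ S : Finset (ℂ × ℂ), (∀ p ∈ S, p.1.re = p.2.re ∨ p.1.im = p.2.im) ∧ frontier Q.carrier ⊆ ⋃ p ∈ S, segment ℝ p.1 p.2) → (∀ u : ℝ, dist (Q.boundary u) (R.boundary u) ≤ ε₀) → (∀ i : Fin 4, |Q.mark i - R.mark i| ≤ ε₀) → ∃ δ₀ > 0, ∀ δ : ℝ, 0 < δ → δ < δ₀ → |P 1 Q δ - P 1 R δ| ≤ ε)) :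
    ∀ (R : ConformalRectangle) (ε : ℝ), 0 < ε → ∃ ε₀ > 0, ∀ Q : ConformalRectangle,
      (∃ S : Finset (ℂ × ℂ), (∀ p ∈ S, p.1.re = p.2.re ∨ p.1.im = p.2.im) ∧
        frontier Q.carrier ⊆ ⋃ p ∈ S, segment ℝ p.1 p.2) →
      (∀ u : ℝ, dist (Q.boundary u) (R.boundary u) ≤ ε₀) → (∀ i : Fin 4, |Q.mark i - R.mark i| ≤ ε₀) →
      ∃ δ₀ > 0, ∀ δ : ℝ, 0 < δ → δ < δ₀ → |Pext Q δ 1 - Pext R δ 1| ≤ ε := by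
  intro R ε hε
  obtain ⟨ε₀, hε₀, hmain⟩ := h₃ R ε hε
  refine ⟨ε₀, hε₀, fun Q hQ hb hm => ?_⟩
  obtain ⟨δ₀, hδ₀, h⟩ := hmain Q hQ hb hm
  refine ⟨δ₀, hδ₀, fun δ hδ hδlt => ?_⟩
  rw [Pext_one, Pext_one]
  exact h δ hδ hδlt

/-- **Child 3 holds**: `FixedDomainContinuityOne` (verbatim) is the landed `fixedDomainContinuity_one` (p140668:
Schramm–Smirnov (5.1) for bond-ℤ² + the Freeze bridge, read through `cornerPercolation_one`). -/
theorem fixedDomainContinuityOne_holds :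
    let prm : unitInterval → Literature.Probability.LatticeModels.Site 2 × Fin 2 → unitInterval := fun t i => if i.2 = 0 then Literature.Probability.Percolation.half else Literature.Probability.Percolation.half * t; let cfg : Set (Literature.Probability.LatticeModels.Site 2 × Fin 2) → Literature.Probability.Percolation.BondConfig (Literature.Probability.LatticeModels.Site 2) := fun S => {e | ∃ v : Literature.Probability.LatticeModels.Site 2, (e = s(v, v + ![1, 0]) ∧ (v, (0 : Fin 2)) ∈ S) ∨ (e = s(v, v + ![0, 1]) ∧ ((v, (0 : Fin 2)) ∈ S ↔ (v, (1 : Fin 2)) ∉ S))}; let P : unitInterval → Literature.Probability.RandomPlanarGeometry.ConformalRectangle → ℝ → ℝ := fun t R δ => (Literature.Probability.LatticeModels.prodBernoulli (prm t)).real {S | cfg S ∈ Literature.Probability.Percolation.embDomainCrossing Literature.Probability.LatticeModels.squareLatticeEmbedding.z R.carrier δ (R.arc 0) (R.arc 2)}; (∀ (R : Literature.Probability.RandomPlanarGeometry.ConformalRectangle) (ε : ℝ), 0 < ε → ∃ ε₀ > 0, ∀ Q : Literature.Probability.RandomPlanarGeometry.ConformalRectangle, (∃ S : Finset (ℂ ×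 ℂ), (∀ p ∈ S, p.1.re = p.2.re ∨ p.1.im = p.2.im) ∧ frontier Q.carrier ⊆ ⋃ p ∈ S, segment ℝ p.1 p.2) → (∀ u : ℝ, dist (Q.boundary u) (R.boundary u) ≤ ε₀) → (∀ i : Fin 4, |Q.mark i - R.mark i| ≤ ε₀) → ∃ δ₀ > 0, ∀ δ : ℝ, 0 < δ → δ < δ₀ → |P 1 Q δ - P 1 R δ| ≤ ε) := by
  intro prm cfg P R ε hε
  obtain ⟨ε₀, hε₀, hmain⟩ := fixedDomainContinuity_one R ε hε
  refine ⟨ε₀, hε₀, fun Q hQ hb hm => ?_⟩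
  obtain ⟨δ₀, hδ₀, h⟩ := hmain Q hQ hb hm
  refine ⟨δ₀, hδ₀, fun δ hδ hδlt => ?_⟩
  have key := h δ hδ hδlt
  have hP : ∀ R' : ConformalRectangle, P 1 R' δ = Pext R' δ 1 := fun R' => by
    rw [Pext_one]
    rfl
  rw [hP Q, hP R]
  exact key

/-- **GLUE OF THE SPLIT**: the three children (`UniformMarginalityRect`, `FixedDomainContinuityInterior`,
`FixedDomainContinuityOne`, each verbatim in the route's `let`-style) imply the crux
`CardySelfDualSegment.UniformMarginality` by name — child 1 is stub (B₁) by
`uniformMarginalityRect_iff_integratedBoundRectilinear` (p137344); case glue over `t₀ ∈ {0} ∪ (0,1) ∪ {1}` with the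
landed base-point kernel `fixedDomainContinuity_zero` (p116559); then the landed v6 chain (sandwich glue p116281,
transport p111792, MVT glue p96304). -/
theorem UniformMarginality_of_subs :
    (let prm : unitInterval → Literature.Probability.LatticeModels.Site 2 × Fin 2 → unitInterval := fun t i => if i.2 = 0 then Literature.Probability.Percolation.half else Literature.Probability.Percolation.half * t; let cfg : Set (Literature.Probability.LatticeModels.Site 2 × Fin 2) → Literature.Probability.Percolation.BondConfig (Literature.Probability.LatticeModels.Site 2) := fun S => {e | ∃ v : Literature.Probability.LatticeModels.Site 2, (e = s(v, v + ![1, 0]) ∧ (v, (0 : Fin 2)) ∈ S) ∨ (e = s(v, v + ![0, 1]) ∧ ((v, (0 : Fin 2)) ∈ S ↔ (v, (1 : Fin 2)) ∉ S))}; let P : unitInterval → Literature.Probability.RandomPlanarGeometry.ConformalRectangle → ℝ → ℝ := fun t R δ => (Literature.Probability.LatticeModels.prodBernoulli (prm t)).real {S | cfg S ∈ Literature.Probability.Percolation.embDomainCrossing Literature.Probability.LatticeModels.squareLatticeEmbedding.z R.carrier δ (R.arc 0) (R.arc 2)}; (∀ (t₀ : unitInterval) (R : Literature.Probability.RandomPlanarGeometry.ConformalRectangle),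 (∃ S : Finset (ℂ × ℂ), (∀ p ∈ S, p.1.re = p.2.re ∨ p.1.im = p.2.im) ∧ frontier R.carrier ⊆ ⋃ p ∈ S, segment ℝ p.1 p.2) → ∀ (ε : ℝ), 0 < ε → ∃ η > 0, ∀ t : unitInterval, dist t t₀ < η → ∀ δ : ℝ, 0 < δ → |P t R δ - P t₀ R δ| < ε)) → (let prm : unitInterval → Literature.Probability.LatticeModels.Site 2 × Fin 2 → unitInterval := fun t i => if i.2 = 0 then Literature.Probability.Percolation.half else Literature.Probability.Percolation.half * t; let cfg : Set (Literature.Probability.LatticeModels.Site 2 × Fin 2) → Literature.Probability.Percolation.BondConfig (Literature.Probability.LatticeModels.Site 2) := fun S => {e | ∃ v : Literature.Probability.LatticeModels.Site 2, (e = s(v, v + ![1, 0]) ∧ (v, (0 : Fin 2)) ∈ S) ∨ (e = s(v, v + ![0, 1]) ∧ ((v, (0 : Fin 2)) ∈ S ↔ (v, (1 : Fin 2)) ∉ S))}; let P : unitInterval → Literature.Probability.RandomPlanarGeometry.ConformalRectangle → ℝ → ℝ := fun t R δ => (Literature.Probability.LatticeModels.prodBernoulli (prm t)).real {S | cfg S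 ∈ Literature.Probability.Percolation.embDomainCrossing Literature.Probability.LatticeModels.squareLatticeEmbedding.z R.carrier δ (R.arc 0) (R.arc 2)}; (∀ (R : Literature.Probability.RandomPlanarGeometry.ConformalRectangle) (t₀ : unitInterval), 0 < (t₀ : ℝ) → (t₀ : ℝ) < 1 → ∀ (ε : ℝ), 0 < ε → ∃ ε₀ > 0, ∀ Q : Literature.Probability.RandomPlanarGeometry.ConformalRectangle, (∃ S : Finset (ℂ × ℂ), (∀ p ∈ S, p.1.re = p.2.re ∨ p.1.im = p.2.im) ∧ frontier Q.carrier ⊆ ⋃ p ∈ S, segment ℝ p.1 p.2) → (∀ u : ℝ, dist (Q.boundary u) (R.boundary u) ≤ ε₀) → (∀ i : Fin 4, |Q.mark i - R.mark i| ≤ ε₀) → ∃ δ₀ > 0, ∀ δ : ℝ, 0 < δ → δ < δ₀ → |P t₀ Q δ - P t₀ R δ| ≤ ε)) → (let prm : unitInterval → Literature.Probability.LatticeModels.Site 2 × Fin 2 → unitInterval := fun t i => if i.2 = 0 then Literature.Probability.Percolation.half else Literature.Probability.Percolation.half * t; let cfg : Set (Literature.Probability.LatticeModels.Site 2 × Fin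 2) → Literature.Probability.Percolation.BondConfig (Literature.Probability.LatticeModels.Site 2) := fun S => {e | ∃ v : Literature.Probability.LatticeModels.Site 2, (e = s(v, v + ![1, 0]) ∧ (v, (0 : Fin 2)) ∈ S) ∨ (e = s(v, v + ![0, 1]) ∧ ((v, (0 : Fin 2)) ∈ S ↔ (v, (1 : Fin 2)) ∉ S))}; let P : unitInterval → Literature.Probability.RandomPlanarGeometry.ConformalRectangle → ℝ → ℝ := fun t R δ => (Literature.Probability.LatticeModels.prodBernoulli (prm t)).real {S | cfg S ∈ Literature.Probability.Percolation.embDomainCrossing Literature.Probability.LatticeModels.squareLatticeEmbedding.z R.carrier δ (R.arc 0) (R.arc 2)}; (∀ (R : Literature.Probability.RandomPlanarGeometry.ConformalRectangle) (ε : ℝ), 0 < ε → ∃ ε₀ > 0, ∀ Q : Literature.Probability.RandomPlanarGeometry.ConformalRectangle, (∃ S : Finset (ℂ × ℂ), (∀ p ∈ S, p.1.re = p.2.re ∨ p.1.im = p.2.im) ∧ frontier Q.carrier ⊆ ⋃ p ∈ S, segment ℝ p.1 p.2) → (∀ u : ℝ, dist (Q.boundary u) (R.boundary u) ≤ ε₀)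 → (∀ i : Fin 4, |Q.mark i - R.mark i| ≤ ε₀) → ∃ δ₀ > 0, ∀ δ : ℝ, 0 < δ → δ < δ₀ → |P 1 Q δ - P 1 R δ| ≤ ε)) → Summit.CriticalPhenomena.CardyFormulaZ2.Theses.CardySelfDualSegment.UniformMarginality :=
  fun h₁ h₂ h₃ =>
    uniformMarginality_of_integratedBound
      (stub_transportOfUniformSandwich
        (stub_uniformSandwichOfFixedDomainContinuity
          (fixedDomainContinuity_of_cases fixedDomainContinuity_zero (fixedDomainContinuity_one_of_sub h₃)
            (fixedDomainContinuity_interior_of_sub h₂))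
          (uniformMarginalityRect_iff_integratedBoundRectilinear.mp h₁))
        (uniformMarginalityRect_iff_integratedBoundRectilinear.mp h₁))

/-- **The crux from children 1 and 2 alone** (child 3 discharged by `fixedDomainContinuityOne_holds`):
`UniformMarginalityRect → FixedDomainContinuityInterior → CardySelfDualSegment.UniformMarginality`. -/
theorem UniformMarginality_of_two_subs :
    (let prm : unitInterval → Literature.Probability.LatticeModels.Site 2 × Fin 2 → unitInterval := fun t i => if i.2 = 0 then Literature.Probability.Percolation.half else Literature.Probability.Percolation.half * t; let cfg : Set (Literature.Probability.LatticeModels.Site 2 × Fin 2) → Literature.Probability.Percolation.BondConfig (Literature.Probability.LatticeModels.Site 2) := fun S => {e | ∃ v : Literature.Probability.LatticeModels.Site 2, (e = s(v, v + ![1, 0]) ∧ (v, (0 : Fin 2)) ∈ S) ∨ (e = s(v, v + ![0, 1]) ∧ ((v, (0 : Fin 2)) ∈ S ↔ (v, (1 : Fin 2)) ∉ S))}; let P : unitInterval → Literature.Probability.RandomPlanarGeometry.ConformalRectangle → ℝ → ℝ := fun t R δ => (Literature.Probability.LatticeModels.prodBernoulli (prm t)).real {S | cfg S ∈ Literature.Probability.Percolation.embDomainCrossing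 Literature.Probability.LatticeModels.squareLatticeEmbedding.z R.carrier δ (R.arc 0) (R.arc 2)}; (∀ (t₀ : unitInterval) (R : Literature.Probability.RandomPlanarGeometry.ConformalRectangle), (∃ S : Finset (ℂ × ℂ), (∀ p ∈ S, p.1.re = p.2.re ∨ p.1.im = p.2.im) ∧ frontier R.carrier ⊆ ⋃ p ∈ S, segment ℝ p.1 p.2) → ∀ (ε : ℝ), 0 < ε → ∃ η > 0, ∀ t : unitInterval, dist t t₀ < η → ∀ δ : ℝ, 0 < δ → |P t R δ - P t₀ R δ| < ε)) → (let prm : unitInterval → Literature.Probability.LatticeModels.Site 2 × Fin 2 → unitInterval := fun t i => if i.2 = 0 then Literature.Probability.Percolation.half else Literature.Probability.Percolation.half * t; let cfg : Set (Literature.Probability.LatticeModels.Site 2 × Fin 2) → Literature.Probability.Percolation.BondConfig (Literature.Probability.LatticeModels.Site 2) := fun S => {e | ∃ v : Literature.Probability.LatticeModels.Site 2, (e = s(v, v + ![1, 0]) ∧ (v, (0 : Fin 2)) ∈ S) ∨ (e = s(v, v + ![0, 1]) ∧ ((v, (0 : Fin 2)) ∈ S ↔ (v, (1 : Fin 2))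 ∉ S))}; let P : unitInterval → Literature.Probability.RandomPlanarGeometry.ConformalRectangle → ℝ → ℝ := fun t R δ => (Literature.Probability.LatticeModels.prodBernoulli (prm t)).real {S | cfg S ∈ Literature.Probability.Percolation.embDomainCrossing Literature.Probability.LatticeModels.squareLatticeEmbedding.z R.carrier δ (R.arc 0) (R.arc 2)}; (∀ (R : Literature.Probability.RandomPlanarGeometry.ConformalRectangle) (t₀ : unitInterval), 0 < (t₀ : ℝ) → (t₀ : ℝ) < 1 → ∀ (ε : ℝ), 0 < ε → ∃ ε₀ > 0, ∀ Q : Literature.Probability.RandomPlanarGeometry.ConformalRectangle, (∃ S : Finset (ℂ × ℂ), (∀ p ∈ S, p.1.re = p.2.re ∨ p.1.im = p.2.im) ∧ frontier Q.carrier ⊆ ⋃ p ∈ S, segment ℝ p.1 p.2) → (∀ u : ℝ, dist (Q.boundary u) (R.boundary u) ≤ ε₀) → (∀ i : Fin 4, |Q.mark i - R.mark i| ≤ ε₀) → ∃ δ₀ > 0, ∀ δ : ℝ, 0 < δ → δ < δ₀ → |P t₀ Q δ - P t₀ R δ| ≤ ε)) → Summit.CriticalPhenomena.CardyFormulaZ2.Theses.CardySelfDualSegment.UniformMarginality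 :=
  fun h₁ h₂ => UniformMarginality_of_subs h₁ h₂ fixedDomainContinuityOne_holds

end Summit.CriticalPhenomena.CardyFormulaZ2.Cruxes.UniformMarginality.HeatFlow.Split

end
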